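import Summits.Ventures.FusionMHD.Models.TearingFRS1EqSuydam
import Summits.Ventures.FusionMHD.Models.TearingFRS1EqIdealSigmaBoundR5
import Summits.Ventures.FusionMHD.Models.TearingFRS1EqIdealSigmaBoundR10
import HarnessLib

/-!
# F1.SUYDAM on lit-4's MODEL M of the σ-rows #66 «F3.σ-FRS1EQ-IDEAL21» (`R₀ = 5a`) / «#66′ R10» (`R₀ = 10a`): Suydam's criterion
# FAILS in the core and HOLDS outside (exact radius `r_S`), the exact value at the `(2,1)` surface, a NEGATIVE-ENERGY internal
# (3,2) [resp. (17,12)] displacement of MODEL M by Newcomb–Suydam necessity, and the toroidal Mercier reversal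
(venture LADDER-GRIDFUSION, rung F1 / MODEL-VALIDITY of F3.σ; cell `gridfusion`, seat `gridfusion-model-7` (g2), 2026-08-27; 0 kit.
Inputs BY NAME: gridfusion-lit-4's `EqSigmaR5.{hl5,u5,p5}` / `EqSigmaR10.{hl10,u10,p10}` (`Models/TearingFRS1EqIdealSigmaBound{R5,R10}`,
p519427 / p519625); the `c`-family algebra of `Models/TearingFRS1EqSuydam.lean` (this seat); gridfusion-lit-3's `ScrewPinch.Profile`
predicates and `suydamNecessity_holds` (p470054).)

## The statement (three columns, never merged)
MODEL M (MODELLED): lit-4's EXACT force-balanced FRS1 screw pinch, `μ₀ = 1`, `B_z ≡ 1`, `B_θ = r·u`, `u = c/(1 + r²)`,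
`p = c²/(2(1 + r²)²) − c²/8 + δ`; `c = 1/7`, `δ = 1/19600` (`hl5`, `R₀ = 5a`) | `c = 1/14`, `δ = 1/78400` (`hl10`, `R₀ = 10a`);
`q = (7/5)(1 + r²)`; straight periodic cylinder `2πR₀`, wall at `a = 1`.  §0 PROVES `hl5.toProfile = eqProfile (1/7) (1/19600)` and
`hl10.toProfile = eqProfile (1/14) (1/78400)` — every statement is literally about lit-4's objects.
CERTIFIED (kernel, this file):
* `R₀ = 5a`: Suydam's criterion (Freidberg (11.109), tree `suydamFun`) is VIOLATED for `0 < r ≤ 0.27545` and SATISFIED for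
  `r ≥ 0.27546`; exact radius **`r_S² = (√65 − 7)/14`** (`r_S = 0.2754552…`; `suydam_neg_iff5`); **`¬ SuydamCriterion 1`**;
  at the `(2,1)` surface `r_s = √(3/7)` (`q = 2`) it HOLDS with the exact value **`suydamFun = (104/1000)·√21`** `= 8 × 13√21/1000`
  (`suydam_at_rs5`: lit-4's informative margin «`p′ + rB_z²(μ′/μ)²/8 = 13√21/1000`» of p519427 is now a kernel value);
  **NEGATIVE-ENERGY DISPLACEMENT**: the helicity `(m, n) = (3, 2)` (`k = −n/R₀ = −2/5`) is resonant at `r₀² = 1/14` (`q = 3/2`)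
  inside the violating core (`15/196 < 16/196`), so by `suydamNecessity_holds` MODEL M has a `C¹` internal trial displacement,
  compactly supported in `(0, 1)`, with `∫₀¹ (f ξ′² + g ξ²) dr < 0` for `(m, k) = (3, −2/5)` (`exists_negative_energy_32_R5`).
* `R₀ = 10a`: violated for `0 < r ≤ 0.14144`, satisfied for `r ≥ 0.14145`, `r_S² = (√53 − 7)/14` (`r_S = 0.1414491…`),
  `¬ SuydamCriterion 1`; helicity `(17, 12)` (`k = −6/5`) resonant at `r₀² = 1/84` (`q = 17/12`) in the core ⇒ negative-energy
  internal displacement (`exists_negative_energy_1712_R10`).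
* TOROIDAL CONTEXT (kernel remark, printed criterion Freidberg (12.86)): the circular-tokamak Mercier criterion of the SAME
  `q = (7/5)(1 + r²)` and pressure holds on every `(0, a)` (`mercierCircularCriterion5/10`).
READING (what this is and is not).  The σ-rows #66 / #66′ certify, for MODEL M, a growth-rate bound for CLASS C = the single
ideal mode `(m, n) = (2, 1)`, resonant at `r_s² = 3/7` OUTSIDE the Suydam-violating core (value `> 0` above).  This file
certifies that the SAME cylindrical MODEL M is NOT ideal-stable against the DIFFERENT class C′ = localized internal interchanges of
core-resonant helicity: an admissible displacement with negative second-order ideal energy exists (energy-principle sense; no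
growth rate claimed).  No conflict — different classes — and together the honest MODEL-VALIDITY line for every FRS1-EQ
σ-sentence reads: «cylindrical MODEL M violates Suydam on `(0, r_S)`; the (2,1) σ-bound is a class-C statement; in the tokamak
ordering the `(1 − q²)` Mercier factor with `q₀ = 7/5 > 1` restores local-interchange stability of these profiles».  MODELLED, not
certified: that the cylinder describes any torus; the dynamical reading of the energy principle.  Nothing here says any plasma or
device is stable or unstable.  VALIDATED: none needed (exact algebra; the decimals 0.27545/0.27546, 0.14144/0.14145 are certified
one-sided bounds).  Box set (solver-free kernel row): L = this file + `…EqSuydam`; D = none (no bench literal); R1 = exact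
arithmetic (`r_S`, `104√21/1000`, the resonance identities); R2 = Freidberg (11.109)/(12.86) read + class wording.
No `native_decide`, no `decide`; `norm_num` / `linarith` / `nlinarith` / `field_simp` / `ring` only.
ROW OF RECORD (docstring-only note, 2026-08-27): ★ #82 «F3.σ-SUYDAM-FRS1EQ-CORE» (lead g6 12:07:39Z; R1 gridfusion-ref-5 LEDGER-5 row 7,
R2 gridfusion-ref-2 LEDGER-2 row 268; the decimal brackets are for `r_S` itself, erratum 12:11:46Z).  GENERIC THEOREM (cited, not used in
the proofs below): these core violations are the FRS1-EQ INSTANCES of gridfusion-lit-3's profile-independent near-axis theorem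
`Literature/MathematicalPhysics/MHD/SuydamNearAxis.lean` (p529346, row #89 «F3.σ-SUYDAM-AXIS-THM»; Freidberg §11.6.1 (11.173)–(11.175),
§11.7.4 (11.249) «always violated near the axis unless the pressure is flattened»): `ScrewPinch.Profile.eventually_suydamFun_neg`
(hypotheses `|B_z| ≤ M`, `|pitch′/pitch| ≤ C·r`, `p′(r)/r → p₂ < 0` near `0⁺`; here `B_z ≡ 1`, `pitch′/pitch = 2r/(1 + r²) ≤ 2r`,
`p′/r = −2c²/(1 + r²)³ → −2c² < 0`), `not_suydamCriterion_of_peaked`, `exists_fluidEnergy_neg_of_resonance_near_axis`; this file's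
closed form gives the EXACT violation radius `r_S` that the generic theorem leaves implicit.
-/

noncomputable section

open Set
open Literature.MathematicalPhysics.MHD

namespace Summit.Ventures.FusionMHD.Models

namespace TearingFRS1

open EqSuydam

/-! ## §0 lit-4's two MODELS M are members of the `eqProfile` family -/

/-- `hl5.toProfile = eqProfile (1/7) (1/19600)` (lit-4's `R₀ = 5a` MODEL M). [instance data] -/
theorem EqSuydam.eqProfile_one_seventh : EqSigmaR5.hl5.toProfile = eqProfile (1 / 7) (1 / 19600) := by
  show ScrewPinch.Profile.mk 1 (fun r => r * EqSigmaR5.u5 r) (fun _ => 1) EqSigmaR5.p5 = ScrewPinch.Profile.mk _ _ _ _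
  congr 1
  · funext r; unfold EqSigmaR5.u5; field_simp
  · funext r; unfold EqSigmaR5.p5; field_simp; ring

/-- `hl10.toProfile = eqProfile (1/14) (1/78400)` (lit-4's `R₀ = 10a` MODEL M). [instance data] -/
theorem EqSuydam.eqProfile_one_fourteenth : EqSigmaR10.hl10.toProfile = eqProfile (1 / 14) (1 / 78400) := by
  show ScrewPinch.Profile.mk 1 (fun r => r * EqSigmaR10.u10 r) (fun _ => 1) EqSigmaR10.p10 = ScrewPinch.Profile.mk _ _ _ _
  congr 1
  · funext r; unfold EqSigmaR10.u10; field_simp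
  · funext r; unfold EqSigmaR10.p10; field_simp; ring

/-! ## §1 THE TWO INSTANCES OF RECORD: `R₀ = 5a` (`hl5`, #66) and `R₀ = 10a` (`hl10`, «#66′ R10») -/


/-- **R₀ = 5a, CORE VIOLATION**: for `0 < r ≤ 0.27545` Suydam's criterion FAILS on MODEL M `hl5` (`r²(1+r²) < 4/49`).
[cite: Freidberg2014, §11.5.2 eq. (11.109)] -/
theorem suydam_core_neg5 {r : ℝ} (hr : 0 < r) (hrS : r ≤ 27545 / 100000) : EqSigmaR5.hl5.toProfile.suydamFun r < 0 := by
  rw [eqProfile_one_seventh, suydamFun_neg_iff (by norm_num) hr]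
  have hr2 : r ^ 2 ≤ (27545 / 100000 : ℝ) ^ 2 := pow_le_pow_left₀ hr.le hrS 2
  nlinarith [mul_le_mul hr2 (by linarith : 1 + r ^ 2 ≤ 1 + (27545 / 100000 : ℝ) ^ 2) (by positivity) (by norm_num)]

/-- **R₀ = 5a, OUTER VALIDITY**: for `r ≥ 0.27546` Suydam's criterion HOLDS on MODEL M `hl5`. [cite: Freidberg2014, §11.5.2 eq. (11.109)] -/
theorem suydam_outer_pos5 {r : ℝ} (hrS : 27546 / 100000 ≤ r) : 0 < EqSigmaR5.hl5.toProfile.suydamFun r := by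
  have hr : 0 < r := lt_of_lt_of_le (by norm_num) hrS
  rw [eqProfile_one_seventh, suydamFun_pos_iff (by norm_num) hr]
  have hr2 : (27546 / 100000 : ℝ) ^ 2 ≤ r ^ 2 := pow_le_pow_left₀ (by norm_num) hrS 2
  nlinarith [mul_le_mul hr2 (by linarith : 1 + (27546 / 100000 : ℝ) ^ 2 ≤ 1 + r ^ 2) (by norm_num) (sq_nonneg r)]

/-- **R₀ = 5a, EXACT SUYDAM RADIUS** `r_S² = (√65 − 7)/14` (`r_S ≈ 0.275455`): for `r > 0`, violated iff `r² < r_S²`.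
[cite: Freidberg2014, §11.5.2 eq. (11.109)] -/
theorem suydam_neg_iff5 {r : ℝ} (hr : 0 < r) : EqSigmaR5.hl5.toProfile.suydamFun r < 0 ↔ r ^ 2 < (Real.sqrt 65 - 7) / 14 := by
  rw [eqProfile_one_seventh, suydamFun_neg_iff_sq_lt (by norm_num) hr]
  have e : tS (1 / 7) = (Real.sqrt 65 - 7) / 14 := by
    unfold tS
    have : Real.sqrt (1 + 16 * (1 / 7 : ℝ) ^ 2) = Real.sqrt 65 / 7 := by
      rw [show (1 : ℝ) + 16 * (1 / 7) ^ 2 = 65 / 7 ^ 2 by norm_num, Real.sqrt_div' _ (by norm_num), Real.sqrt_sq (by norm_num)]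
    rw [this]; ring
  rw [e]

/-- **R₀ = 5a: SUYDAM'S CRITERION FAILS on `(0, 1)`** (the plasma column of MODEL M). [cite: Freidberg2014, §11.5.2 eq. (11.109)] -/
theorem not_suydamCriterion5 : ¬ EqSigmaR5.hl5.toProfile.SuydamCriterion 1 := by
  rw [eqProfile_one_seventh]; exact not_suydamCriterion (by norm_num) one_pos

/-- **R₀ = 5a, the (2,1) surface**: at `r_s = √(3/7)` (`q = 2`) Suydam HOLDS with the exact value `(104/1000)·√21`
`= 8 × (13√21/1000)` (lit-4's informative margin «p′ + rB_z²(q′/q)²/8 = 13√21/1000», now a kernel value).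
[cite: Freidberg2014, §11.5.2 eq. (11.109)] -/
theorem suydam_at_rs5 : EqSigmaR5.hl5.toProfile.suydamFun (Real.sqrt (3 / 7)) = 104 / 1000 * Real.sqrt 21 := by
  have hr : Real.sqrt (3 / 7) ≠ 0 := Real.sqrt_ne_zero'.2 (by norm_num)
  have hsq : Real.sqrt (3 / 7) ^ 2 = 3 / 7 := Real.sq_sqrt (by norm_num)
  have h21 : Real.sqrt (3 / 7) = Real.sqrt 21 / 7 := by
    rw [show (3 / 7 : ℝ) = 21 / 7 ^ 2 by norm_num, Real.sqrt_div' _ (by norm_num), Real.sqrt_sq (by norm_num)]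
  rw [eqProfile_one_seventh, suydamFun_eq (by norm_num) hr]
  rw [show Real.sqrt (3 / 7) ^ 2 * (1 + Real.sqrt (3 / 7) ^ 2) - 4 * (1 / 7 : ℝ) ^ 2 = 26 / 49 by rw [hsq]; norm_num,
    show ((1 : ℝ) + Real.sqrt (3 / 7) ^ 2) ^ 3 = 1000 / 343 by rw [hsq]; norm_num, h21]
  ring

/-- **R₀ = 5a — NEGATIVE-ENERGY (3,2) DISPLACEMENT OF MODEL M**: the `(m, n) = (3, 2)` helicity (`k = −n/R₀ = −2/5`) is
RESONANT at `r₀ = √(1/14)` (`q(r₀) = 3/2`), which lies in the Suydam-violating core (`r₀²(1 + r₀²) = 15/196 < 16/196`);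
by Newcomb–Suydam necessity (tree theorem) there is a `C¹` internal trial displacement, compactly supported in `(0, 1)`,
with `∫₀¹ (f ξ′² + g ξ²) dr < 0` for `(m, k) = (3, −2/5)`.  THREE COLUMNS: CERTIFIED = this existence statement for MODEL M
(cylinder); it says MODEL M is NOT ideal-stable against the class of localized INTERNAL interchanges of helicity (3,2) —
a DIFFERENT class from the single `(2,1)` mode of the σ-rows (#66), whose resonant surface `r_s² = 3/7` lies OUTSIDE the
violating core (`suydam_at_rs5 > 0`); MODELLED = straight periodic cylinder `2πR₀`, `R₀ = 5a`; the toroidal `(1 − q²)`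
factor reverses the core sign (§4).  Nothing here says any plasma or device is stable or unstable.
[cite: Freidberg2014, §11.5.2 eq. (11.109)] -/
theorem exists_negative_energy_32_R5 :
    ∃ ξ : ℝ → ℝ, ContDiff ℝ 1 ξ ∧ tsupport ξ ⊆ Ioo 0 1 ∧ EqSigmaR5.hl5.toProfile.fluidEnergy 3 (-2 / 5) 1 ξ < 0 := by
  have hr₀ : 0 < Real.sqrt (1 / 14) := Real.sqrt_pos.2 (by norm_num)
  have hsq : Real.sqrt (1 / 14) ^ 2 = 1 / 14 := Real.sq_sqrt (by norm_num)
  have hr₀1 : Real.sqrt (1 / 14) < 1 := by nlinarith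
  have hk : (-(3 * (1 / 7 : ℝ)) / (1 + Real.sqrt (1 / 14) ^ 2)) = -2 / 5 := by rw [hsq]; norm_num
  have hcore : Real.sqrt (1 / 14) ^ 2 < tS (1 / 7) := by
    rw [← mul_one_add_lt_iff (sq_nonneg _) (1 / 7), hsq]; norm_num
  rw [eqProfile_one_seventh, ← hk]
  exact exists_negative_energy (by norm_num) hr₀ hr₀1 (by norm_num) hcore

/-- **R₀ = 5a, toroidal context**: the circular-tokamak Mercier criterion of the same `q = (7/5)(1 + r²)`, `p = p5` holds on
`(0, a)` for every `a`. [cite: Freidberg2014, §12.5.4 eq. (12.86)] -/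
theorem mercierCircularCriterion5 (a : ℝ) : (radialProfile (7 / 5) (1 / 7) (1 / 19600)).MercierCircularCriterion a :=
  mercierCircularCriterion (by norm_num) (by norm_num) a

/-- **R₀ = 10a, CORE VIOLATION**: for `0 < r ≤ 0.14144` Suydam FAILS on `hl10` (`r²(1+r²) < 1/49`). [cite: Freidberg2014, §11.5.2 eq. (11.109)] -/
theorem suydam_core_neg10 {r : ℝ} (hr : 0 < r) (hrS : r ≤ 14144 / 100000) : EqSigmaR10.hl10.toProfile.suydamFun r < 0 := by
  rw [eqProfile_one_fourteenth, suydamFun_neg_iff (by norm_num) hr]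
  have hr2 : r ^ 2 ≤ (14144 / 100000 : ℝ) ^ 2 := pow_le_pow_left₀ hr.le hrS 2
  nlinarith [mul_le_mul hr2 (by linarith : 1 + r ^ 2 ≤ 1 + (14144 / 100000 : ℝ) ^ 2) (by positivity) (by norm_num)]

/-- **R₀ = 10a, OUTER VALIDITY**: for `r ≥ 0.14145` Suydam HOLDS on `hl10`. [cite: Freidberg2014, §11.5.2 eq. (11.109)] -/
theorem suydam_outer_pos10 {r : ℝ} (hrS : 14145 / 100000 ≤ r) : 0 < EqSigmaR10.hl10.toProfile.suydamFun r := by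
  have hr : 0 < r := lt_of_lt_of_le (by norm_num) hrS
  rw [eqProfile_one_fourteenth, suydamFun_pos_iff (by norm_num) hr]
  have hr2 : (14145 / 100000 : ℝ) ^ 2 ≤ r ^ 2 := pow_le_pow_left₀ (by norm_num) hrS 2
  nlinarith [mul_le_mul hr2 (by linarith : 1 + (14145 / 100000 : ℝ) ^ 2 ≤ 1 + r ^ 2) (by norm_num) (sq_nonneg r)]

/-- **R₀ = 10a, EXACT SUYDAM RADIUS** `r_S² = (√53 − 7)/14` (`r_S ≈ 0.1414491`). [cite: Freidberg2014, §11.5.2 eq. (11.109)] -/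
theorem suydam_neg_iff10 {r : ℝ} (hr : 0 < r) : EqSigmaR10.hl10.toProfile.suydamFun r < 0 ↔ r ^ 2 < (Real.sqrt 53 - 7) / 14 := by
  rw [eqProfile_one_fourteenth, suydamFun_neg_iff_sq_lt (by norm_num) hr]
  have e : tS (1 / 14) = (Real.sqrt 53 - 7) / 14 := by
    unfold tS
    have : Real.sqrt (1 + 16 * (1 / 14 : ℝ) ^ 2) = Real.sqrt 53 / 7 := by
      rw [show (1 : ℝ) + 16 * (1 / 14) ^ 2 = 53 / 7 ^ 2 by norm_num, Real.sqrt_div' _ (by norm_num), Real.sqrt_sq (by norm_num)]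
    rw [this]; ring
  rw [e]

/-- **R₀ = 10a: SUYDAM'S CRITERION FAILS on `(0, 1)`.** [cite: Freidberg2014, §11.5.2 eq. (11.109)] -/
theorem not_suydamCriterion10 : ¬ EqSigmaR10.hl10.toProfile.SuydamCriterion 1 := by
  rw [eqProfile_one_fourteenth]; exact not_suydamCriterion (by norm_num) one_pos

/-- **R₀ = 10a — NEGATIVE-ENERGY (17,12) DISPLACEMENT OF MODEL M**: `(m, n) = (17, 12)` (`k = −12/10 = −6/5`) is resonant
at `r₀² = 1/84` (`q = 17/12`), inside the violating core (`(1/84)(85/84) = 85/7056 < 1/49`); Newcomb–Suydam necessity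
gives a `C¹` internal displacement with negative reduced energy for `(m, k) = (17, −6/5)`.  Same three columns as the
`R₀ = 5a` statement. [cite: Freidberg2014, §11.5.2 eq. (11.109)] -/
theorem exists_negative_energy_1712_R10 :
    ∃ ξ : ℝ → ℝ, ContDiff ℝ 1 ξ ∧ tsupport ξ ⊆ Ioo 0 1 ∧ EqSigmaR10.hl10.toProfile.fluidEnergy 17 (-6 / 5) 1 ξ < 0 := by
  have hr₀ : 0 < Real.sqrt (1 / 84) := Real.sqrt_pos.2 (by norm_num)
  have hsq : Real.sqrt (1 / 84) ^ 2 = 1 / 84 := Real.sq_sqrt (by norm_num)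
  have hr₀1 : Real.sqrt (1 / 84) < 1 := by nlinarith
  have hk : (-(17 * (1 / 14 : ℝ)) / (1 + Real.sqrt (1 / 84) ^ 2)) = -6 / 5 := by rw [hsq]; norm_num
  have hcore : Real.sqrt (1 / 84) ^ 2 < tS (1 / 14) := by
    rw [← mul_one_add_lt_iff (sq_nonneg _) (1 / 14), hsq]; norm_num
  rw [eqProfile_one_fourteenth, ← hk]
  exact exists_negative_energy (by norm_num) hr₀ hr₀1 (by norm_num) hcore

/-- **R₀ = 10a, toroidal context**: the circular-tokamak Mercier criterion of `q = (7/5)(1 + r²)`, `p = p10` holds on every `(0, a)`.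
[cite: Freidberg2014, §12.5.4 eq. (12.86)] -/
theorem mercierCircularCriterion10 (a : ℝ) : (radialProfile (7 / 5) (1 / 14) (1 / 78400)).MercierCircularCriterion a :=
  mercierCircularCriterion (by norm_num) (by norm_num) a

end TearingFRS1

end Summit.Ventures.FusionMHD.Models

end
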